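import Summits.AnomalousDissipation.AnomalousDissipation.Theorems.SawtoothPulseCascadeK1LocalisedCascadeHalfStepVCTG
import Summits.AnomalousDissipation.AnomalousDissipation.Theorems.SawtoothPulseCascadeK1LocalisedCascadeHalfStepHCTG
import Summits.AnomalousDissipation.AnomalousDissipation.Theorems.SawtoothPulseCascadeK1LocalisedCascadeTraceKernelsDerivH
import Summits.AnomalousDissipation.AnomalousDissipation.Theorems.SawtoothPulseCascadeK1LocalisedCascadeBlockScalarsCTE

/-!
# K1loc — helper: THE BOX WINDOW OF THE ITERATES IN ALL-ORDERS CORNER-TRACE GRADE, BOX TRAPEZOID («CT-GEO» block brick)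

Helper file of the prover lane on the crux `K1LocalisedCascade` (stmt-AnomalousDissipation-19491), route `SawtoothPulseCascade`
(S-D fibre ledger, corner-trace track; finding F-p1g9-1, memo v15).  The analogue of `…BlockScalarsCTE.sum_window_iterate_{v,h}step_ct_boxE_le`
on the all-orders half-steps `…HalfStep{V,H}CTG`: for the iterates `a_{j+1} = b_j ∘ Φ_V` (resp. `b_j = a_j ∘ Φ_H`), a box window
`|k₀| ≤ K`, `n₀ ≤ |k₁| ≤ Λ'` (sign-symmetric fibre set), the symmetric box trapezoid with plateau `L` and ramps `R` (`L + R ≥ 2`), gap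
`K + (L+R) + D ≤ n₀G`, `K + 1 ≤ n₀G − (L+R−1)`, order `p ≥ 1`, `ε > 0`, zone parameter `M` with `e^{−M²/2} ≤ ε_r`, every scalar is
discharged except the tracked energy `E ≥ Σ_{fibres}Σ_{|l|≤L+R}|𝓕b_j(l,n)|²`:
  `Σ_{k∈W}|𝓕a_{j+1}(k)|² ≤ (√(c₁Θ + c₂E) + √((πΛ'Gε_r/N)²E + 8Mδ_jΘ/π) + √(Σ'_{n₀≤|k₁|≤Λ', L<|k₀|}|𝓕b_j|²))²`,
`Θ = (2L+R)/R` (the box-trapezoid trace ratio; derivative traces by `…TraceKernelsDeriv(H)` with base `Λ = L+R−1`),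
`c₁ = (1+ε)(N²/π²)(8λ′²/(λ′²−K²)² + 8(K+½)/(N(λ′²−(K+½)²)))`, `λ′ = n₀G − (L+R−1)`, `c₂` the order-`p` remainder coefficient.
No definitions; nothing about the crux. [cite: Grafakos2014, Prop. 3.1.2 (5), Prop. 3.2.7 (3)] [problem: turb]
-/

-- `Summit.<Summit>.<Problem>`: single-conjunct summit, the duplicate namespace segment is deliberate.
set_option linter.dupNamespace false

noncomputable section

namespace Summit.AnomalousDissipation.AnomalousDissipation.Theorems.SawtoothPulseCascade.K1Window

open MeasureTheory Set Filter Topology UnitAddTorus Function Complex Metric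
open scoped Real ENNReal
open Literature.Analysis Literature.Analysis.FunctionSpaces Literature.Analysis.FunctionSpaces.Torus Literature.Analysis.FluidPDE
open Literature.Analysis.FluidPDE.ShearStage
open Literature.Analysis.FluidPDE.SawtoothCascade Literature.Analysis.FluidPDE.SawtoothCascade.CascadeParams
open Summit.AnomalousDissipation.AnomalousDissipation.Theorems.SawtoothPulseCascade.K1Start
open Summit.AnomalousDissipation.AnomalousDissipation.Theorems.SawtoothPulseCascade.K1Flat
open Summit.AnomalousDissipation.AnomalousDissipation.Theorems.SawtoothPulseCascade.K1Ledger.From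

section Cascade

variable (P : CascadeParams)

set_option maxHeartbeats 800000 in
/-- **CT-GEO V box window for the iterates, box trapezoid, tracked energy symbolic** (see the file header).
[cite: Grafakos2014, Prop. 3.1.2 (5), Prop. 3.2.7 (3)] -/
theorem sum_window_iterate_vstep_ctg_boxE_le {G : ℕ} (hγ : P.γ = G) (hδ₀ : 0 < P.δ₀) (hd : 0 < P.d) (hN₀ : 1 ≤ P.N₀)
    (hρN : 1 ≤ P.ρN) (a b : ℕ → UnitAddTorus (Fin 2) → ℝ) (has : ∀ j, IsSmooth (a j)) (h0 : a 0 = datum)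
    (hb : ∀ j, b j = a j ∘ shearMap 0 1 (amp ⟨P.U j, P.U_periodic j, P.contDiff_U (P.δ_pos hδ₀ hd j)⟩ P.γ))
    (hab : ∀ j, a (j + 1) = b j ∘ shearMap 1 0 (amp ⟨P.U j, P.U_periodic j, P.contDiff_U (P.δ_pos hδ₀ hd j)⟩ P.γ))
    (j : ℕ) {L R K n₀ Λ' D : ℕ} (hR : 0 < R) (hLR : 2 ≤ L + R) (hD : 0 < D)
    (W : Finset (Fin 2 → ℤ)) (hW : ∀ k ∈ W, (n₀ : ℤ) ≤ |k 1| ∧ |k 1| ≤ Λ') (hWK : ∀ k ∈ W, |k 0| ≤ (K : ℤ))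
    (hKD : (K : ℤ) + ((L + R : ℕ) : ℤ) + D ≤ (n₀ : ℤ) * G) (hedge : (K : ℝ) + 1 ≤ (n₀ : ℝ) * G - (((L + R : ℕ) : ℝ) - 1))
    (hWsym : ∀ n ∈ W.image (fun k => k 1), -n ∈ W.image (fun k => k 1))
    {p : ℕ} (hp : 1 ≤ p) {ε M εr : ℝ} (hε : 0 < ε) (hM : 1 ≤ M) (hMδ : M * P.δ j < π / 2) (hεr : Real.exp (-(M ^ 2 / 2)) ≤ εr)
    {E : ℝ} (hE : ∑ n ∈ W.image (fun k => k 1), ∑ l ∈ Finset.Icc (-((L + R : ℕ) : ℤ)) (L + R : ℕ),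
      ‖mFourierCoeff (fun x => (b j x : ℂ)) ![l, n]‖ ^ 2 ≤ E) :
    ∑ k ∈ W, ‖mFourierCoeff (fun x => (a (j + 1) x : ℂ)) k‖ ^ 2 ≤
      (Real.sqrt ((1 + ε) * ((P.N j : ℝ) ^ 2 / π ^ 2) *
              (8 * ((n₀ : ℝ) * G - (((L + R : ℕ) : ℝ) - 1)) ^ 2 / (((n₀ : ℝ) * G - (((L + R : ℕ) : ℝ) - 1)) ^ 2 - (K : ℝ) ^ 2) ^ 2 +
                8 * ((K : ℝ) + 1 / 2) / (P.N j * (((n₀ : ℝ) * G - (((L + R : ℕ) : ℝ) - 1)) ^ 2 - ((K : ℝ) + 1 / 2) ^ 2))) *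
              ((Real.sqrt ((2 * L + R : ℕ) * R) / R * 1) ^ 2 / 2 + (Real.sqrt ((2 * L + R : ℕ) * R) / R * 1) ^ 2 / 2) +
            (1 + ε⁻¹) * ((P.N j : ℝ) ^ 2 / π ^ 2) * (4 / (D : ℝ) ^ 2 * (1 / ((D : ℝ) + ((L + R : ℕ) : ℝ)) ^ (2 * p) +
              1 / (P.N j * ((D : ℝ) + ((L + R : ℕ) : ℝ)) ^ (2 * p - 1)))) *
              ((2 * ((L + R : ℕ) : ℝ) / P.N j + 1) * ((L + R : ℕ) : ℝ) ^ (2 * p)) * E) +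
          Real.sqrt ((π * ((Λ' * G : ℕ) : ℝ) * εr / P.N j) ^ 2 * E +
            8 * M * P.δ j / π * ((Real.sqrt ((2 * L + R : ℕ) * R) / R * 1) ^ 2 / 2 +
              (Real.sqrt ((2 * L + R : ℕ) * R) / R * 1) ^ 2 / 2)) +
        Real.sqrt (∑' k : Fin 2 → ℤ, (if (n₀ : ℤ) ≤ |k 1| ∧ |k 1| ≤ Λ' ∧ (L : ℤ) < |k 0| then (1 : ℝ) else 0) *
          ‖mFourierCoeff (fun x => (b j x : ℂ)) k‖ ^ 2)) ^ 2 := by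
  classical
  have hNpos : 0 < P.N j := N_pos P hN₀ hρN j
  have hNr : (0 : ℝ) < P.N j := by exact_mod_cast hNpos
  set Ψ : ShearProfile := amp ⟨P.U j, P.U_periodic j, P.contDiff_U (P.δ_pos hδ₀ hd j)⟩ P.γ with hΨ
  set bC : UnitAddTorus (Fin 2) → ℂ := fun x => (b j x : ℂ) with hbC
  have hbs : IsSmooth (b j) := isSmooth_b P hδ₀ hd a b has hb j
  have hb1 : ∀ x, |b j x| ≤ 1 := (abs_iterate_le_one P hδ₀ hd a b h0 hb hab j).2
  have hbc : Continuous bC := Complex.continuous_ofReal.comp hbs.continuous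
  have hbsum : Summable fun k => ‖mFourierCoeff bC k‖ := summable_norm_mFourierCoeff_ofReal_of_isSmooth hbs
  have haC' : (fun x => (a (j + 1) x : ℂ)) = bC ∘ shearMap 1 0 Ψ := by
    show (fun x => (a (j + 1) x : ℂ)) = (fun x => (b j x : ℂ)) ∘ shearMap 1 0 Ψ
    rw [hab j]; rfl
  rw [haC']
  -- the box trapezoid
  set χ : ℤ → ℂ := fun l => (((((Finset.Ico (-(L : ℤ)) (-(L : ℤ) + (2 * L + R : ℕ))) ×ˢ (Finset.Ico (0 : ℤ) R)).filter
        (fun q : ℤ × ℤ => q.1 - q.2 = l)).card : ℂ) / R) with hχ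
  have hχS : ∀ l, l ∉ Finset.Icc (-((L + R : ℕ) : ℤ)) (L + R : ℕ) → χ l = 0 := fun l hl => boxTrapezoid_support L R l hl
  have hχr : ∀ l, ∃ r : ℝ, 0 ≤ r ∧ r ≤ 1 ∧ χ l = (r : ℂ) := boxTrapezoid_real L hR
  have hχ1 : ∀ l : ℤ, |l| ≤ L → χ l = 1 := fun l hl => boxTrapezoid_plateau L hR l hl
  have hχn : ∀ l, ‖χ l‖ ≤ 1 := norm_le_one_of_unitInterval hχr
  have hSL : ∀ l ∈ Finset.Icc (-((L + R : ℕ) : ℤ)) (L + R : ℕ), |l| ≤ ((L + R : ℕ) : ℤ) :=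
    fun l hl => abs_le.mpr (Finset.mem_Icc.mp hl)
  -- the scalars of the half-step
  set Λw : ℝ := ((L + R : ℕ) : ℝ) - 1 with hΛw
  have hΛw0 : 0 < Λw := by
    rw [hΛw]; have : (2 : ℝ) ≤ ((L + R : ℕ) : ℝ) := by exact_mod_cast hLR
    linarith
  have hΛwe : ((L : ℝ) + R - 1) = Λw := by rw [hΛw]; push_cast; ring
  set Θ : ℝ := (Real.sqrt ((2 * L + R : ℕ) * R) / R * 1) ^ 2 / 2 with hΘ
  -- the indexed sign-split traces (`…TraceKernelsDeriv`)
  have hΘpm : ∀ i ∈ Finset.range p, ∀ y : ℝ,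
      ∑ n ∈ (W.image (fun k => k 1)).filter (fun n => 0 < n), ‖∑ l ∈ Finset.Icc (-((L + R : ℕ) : ℤ)) (L + R : ℕ),
        χ l * (l : ℂ) ^ i * mFourierCoeff bC ![l, n] * cexp (2 * π * I * l * y)‖ ^ 2 ≤ Λw ^ (2 * i) * Θ ∧
      ∑ n ∈ (W.image (fun k => k 1)).filter (fun n => n < 0), ‖∑ l ∈ Finset.Icc (-((L + R : ℕ) : ℤ)) (L + R : ℕ),
        χ l * (l : ℂ) ^ i * mFourierCoeff bC ![l, n] * cexp (2 * π * I * l * y)‖ ^ 2 ≤ Λw ^ (2 * i) * Θ := by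
    intro i _ y
    have h := sum_sq_trace_boxTrapezoid_moment_sign_le_v hbs.continuous hb1 L hR (W.image fun k => k 1) hWsym i y
    have e : (((L : ℝ) + R - 1) ^ i * (Real.sqrt ((2 * L + R : ℕ) * R) / R) * 1) ^ 2 / 2 = Λw ^ (2 * i) * Θ := by
      rw [hΛwe, hΘ, pow_mul]; ring
    rw [e] at h
    exact h
  have hWn₀ : ∀ k ∈ W, (n₀ : ℤ) ≤ |k 1| := fun k hk => (hW k hk).1
  have hη : ∀ k ∈ W, 2 * π * |((k 1 * G : ℤ) : ℝ)| * (Real.exp (-(M ^ 2 / 2)) / (2 * P.N j)) ≤ π * ((Λ' * G : ℕ) : ℝ) * εr / P.N j := by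
    intro k hk
    refine le_trans (mul_le_mul_of_nonneg_right (mul_le_mul_of_nonneg_left ?_ (by positivity)) (by positivity))
      (eta_ct_le Λ' G hNpos hεr)
    rw [← Int.cast_abs, abs_mul, abs_of_nonneg (Int.natCast_nonneg G)]
    have : |k 1| * (G : ℤ) ≤ (Λ' : ℤ) * G := mul_le_mul_of_nonneg_right (hW k hk).2 (Int.natCast_nonneg G)
    exact_mod_cast this
  have hedge' : (K : ℝ) + 1 ≤ (n₀ : ℝ) * G - Λw := by rw [hΛw]; exact hedge
  have hmain := sum_window_sq_norm_vstep_ctg_le P hγ hδ₀ hd hN₀ hρN j hbc hbsum W χ _ hχS hχn hSL hD hWK hWn₀ hKD hp hΛw0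
    hedge' hε (Θp := Θ) (Θm := Θ) (fun i hi y => (hΘpm i hi y).1) (fun i hi y => (hΘpm i hi y).2)
    ((sum_sum_sq_norm_mul_le hχn _ _ _).trans hE) hM hMδ hη
  rw [hΛw] at hmain
  refine hmain.trans (pow_le_pow_left₀ (by positivity) (add_le_add le_rfl (Real.sqrt_le_sqrt ?_)) 2)
  exact sum_passThrough_le_tsum hbc hχS hχr hχ1 _ fun n hn => by
    obtain ⟨k, hk, rfl⟩ := Finset.mem_image.mp hn
    exact hW k hk

set_option maxHeartbeats 800000 in
/-- **CT-GEO H box window for the iterates, box trapezoid, tracked energy symbolic** (`a_j ↦ b_j`; fibres `k₀`, window `|k₁| ≤ K`,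
sources in `k₁`). [cite: Grafakos2014, Prop. 3.1.2 (5), Prop. 3.2.7 (3)] -/
theorem sum_window_iterate_hstep_ctg_boxE_le {G : ℕ} (hγ : P.γ = G) (hδ₀ : 0 < P.δ₀) (hd : 0 < P.d) (hN₀ : 1 ≤ P.N₀)
    (hρN : 1 ≤ P.ρN) (a b : ℕ → UnitAddTorus (Fin 2) → ℝ) (has : ∀ j, IsSmooth (a j)) (h0 : a 0 = datum)
    (hb : ∀ j, b j = a j ∘ shearMap 0 1 (amp ⟨P.U j, P.U_periodic j, P.contDiff_U (P.δ_pos hδ₀ hd j)⟩ P.γ))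
    (hab : ∀ j, a (j + 1) = b j ∘ shearMap 1 0 (amp ⟨P.U j, P.U_periodic j, P.contDiff_U (P.δ_pos hδ₀ hd j)⟩ P.γ))
    (j : ℕ) {L R K n₀ Λ' D : ℕ} (hR : 0 < R) (hLR : 2 ≤ L + R) (hD : 0 < D)
    (W : Finset (Fin 2 → ℤ)) (hW : ∀ k ∈ W, (n₀ : ℤ) ≤ |k 0| ∧ |k 0| ≤ Λ') (hWK : ∀ k ∈ W, |k 1| ≤ (K : ℤ))
    (hKD : (K : ℤ) + ((L + R : ℕ) : ℤ) + D ≤ (n₀ : ℤ) * G) (hedge : (K : ℝ) + 1 ≤ (n₀ : ℝ) * G - (((L + R : ℕ) : ℝ) - 1))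
    (hWsym : ∀ n ∈ W.image (fun k => k 0), -n ∈ W.image (fun k => k 0))
    {p : ℕ} (hp : 1 ≤ p) {ε M εr : ℝ} (hε : 0 < ε) (hM : 1 ≤ M) (hMδ : M * P.δ j < π / 2) (hεr : Real.exp (-(M ^ 2 / 2)) ≤ εr)
    {E : ℝ} (hE : ∑ n ∈ W.image (fun k => k 0), ∑ l ∈ Finset.Icc (-((L + R : ℕ) : ℤ)) (L + R : ℕ),
      ‖mFourierCoeff (fun x => (a j x : ℂ)) ![n, l]‖ ^ 2 ≤ E) :
    ∑ k ∈ W, ‖mFourierCoeff (fun x => (b j x : ℂ)) k‖ ^ 2 ≤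
      (Real.sqrt ((1 + ε) * ((P.N j : ℝ) ^ 2 / π ^ 2) *
              (8 * ((n₀ : ℝ) * G - (((L + R : ℕ) : ℝ) - 1)) ^ 2 / (((n₀ : ℝ) * G - (((L + R : ℕ) : ℝ) - 1)) ^ 2 - (K : ℝ) ^ 2) ^ 2 +
                8 * ((K : ℝ) + 1 / 2) / (P.N j * (((n₀ : ℝ) * G - (((L + R : ℕ) : ℝ) - 1)) ^ 2 - ((K : ℝ) + 1 / 2) ^ 2))) *
              ((Real.sqrt ((2 * L + R : ℕ) * R) / R * 1) ^ 2 / 2 + (Real.sqrt ((2 * L + R : ℕ) * R) / R * 1) ^ 2 / 2) +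
            (1 + ε⁻¹) * ((P.N j : ℝ) ^ 2 / π ^ 2) * (4 / (D : ℝ) ^ 2 * (1 / ((D : ℝ) + ((L + R : ℕ) : ℝ)) ^ (2 * p) +
              1 / (P.N j * ((D : ℝ) + ((L + R : ℕ) : ℝ)) ^ (2 * p - 1)))) *
              ((2 * ((L + R : ℕ) : ℝ) / P.N j + 1) * ((L + R : ℕ) : ℝ) ^ (2 * p)) * E) +
          Real.sqrt ((π * ((Λ' * G : ℕ) : ℝ) * εr / P.N j) ^ 2 * E +
            8 * M * P.δ j / π * ((Real.sqrt ((2 * L + R : ℕ) * R) / R * 1) ^ 2 / 2 +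
              (Real.sqrt ((2 * L + R : ℕ) * R) / R * 1) ^ 2 / 2)) +
        Real.sqrt (∑' k : Fin 2 → ℤ, (if (n₀ : ℤ) ≤ |k 0| ∧ |k 0| ≤ Λ' ∧ (L : ℤ) < |k 1| then (1 : ℝ) else 0) *
          ‖mFourierCoeff (fun x => (a j x : ℂ)) k‖ ^ 2)) ^ 2 := by
  classical
  have hNpos : 0 < P.N j := N_pos P hN₀ hρN j
  have hNr : (0 : ℝ) < P.N j := by exact_mod_cast hNpos
  set Ψ : ShearProfile := amp ⟨P.U j, P.U_periodic j, P.contDiff_U (P.δ_pos hδ₀ hd j)⟩ P.γ with hΨ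
  set aC : UnitAddTorus (Fin 2) → ℂ := fun x => (a j x : ℂ) with haC
  have has' : IsSmooth (a j) := has j
  have ha1 : ∀ x, |a j x| ≤ 1 := (abs_iterate_le_one P hδ₀ hd a b h0 hb hab j).1
  have hac : Continuous aC := Complex.continuous_ofReal.comp has'.continuous
  have hasum : Summable fun k => ‖mFourierCoeff aC k‖ := summable_norm_mFourierCoeff_ofReal_of_isSmooth has'
  have hbC' : (fun x => (b j x : ℂ)) = aC ∘ shearMap 0 1 Ψ := by
    show (fun x => (b j x : ℂ)) = (fun x => (a j x : ℂ)) ∘ shearMap 0 1 Ψ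
    rw [hb j]; rfl
  rw [hbC']
  -- the box trapezoid
  set χ : ℤ → ℂ := fun l => (((((Finset.Ico (-(L : ℤ)) (-(L : ℤ) + (2 * L + R : ℕ))) ×ˢ (Finset.Ico (0 : ℤ) R)).filter
        (fun q : ℤ × ℤ => q.1 - q.2 = l)).card : ℂ) / R) with hχ
  have hχS : ∀ l, l ∉ Finset.Icc (-((L + R : ℕ) : ℤ)) (L + R : ℕ) → χ l = 0 := fun l hl => boxTrapezoid_support L R l hl
  have hχr : ∀ l, ∃ r : ℝ, 0 ≤ r ∧ r ≤ 1 ∧ χ l = (r : ℂ) := boxTrapezoid_real L hR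
  have hχ1 : ∀ l : ℤ, |l| ≤ L → χ l = 1 := fun l hl => boxTrapezoid_plateau L hR l hl
  have hχn : ∀ l, ‖χ l‖ ≤ 1 := norm_le_one_of_unitInterval hχr
  have hSL : ∀ l ∈ Finset.Icc (-((L + R : ℕ) : ℤ)) (L + R : ℕ), |l| ≤ ((L + R : ℕ) : ℤ) :=
    fun l hl => abs_le.mpr (Finset.mem_Icc.mp hl)
  set Λw : ℝ := ((L + R : ℕ) : ℝ) - 1 with hΛw
  have hΛw0 : 0 < Λw := by
    rw [hΛw]; have : (2 : ℝ) ≤ ((L + R : ℕ) : ℝ) := by exact_mod_cast hLR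
    linarith
  have hΛwe : ((L : ℝ) + R - 1) = Λw := by rw [hΛw]; push_cast; ring
  set Θ : ℝ := (Real.sqrt ((2 * L + R : ℕ) * R) / R * 1) ^ 2 / 2 with hΘ
  have hΘpm : ∀ i ∈ Finset.range p, ∀ y : ℝ,
      ∑ n ∈ (W.image (fun k => k 0)).filter (fun n => 0 < n), ‖∑ l ∈ Finset.Icc (-((L + R : ℕ) : ℤ)) (L + R : ℕ),
        χ l * (l : ℂ) ^ i * mFourierCoeff aC ![n, l] * cexp (2 * π * I * l * y)‖ ^ 2 ≤ Λw ^ (2 * i) * Θ ∧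
      ∑ n ∈ (W.image (fun k => k 0)).filter (fun n => n < 0), ‖∑ l ∈ Finset.Icc (-((L + R : ℕ) : ℤ)) (L + R : ℕ),
        χ l * (l : ℂ) ^ i * mFourierCoeff aC ![n, l] * cexp (2 * π * I * l * y)‖ ^ 2 ≤ Λw ^ (2 * i) * Θ := by
    intro i _ y
    have h := sum_sq_trace_boxTrapezoid_moment_sign_le_h has'.continuous ha1 L hR (W.image fun k => k 0) hWsym i y
    have e : (((L : ℝ) + R - 1) ^ i * (Real.sqrt ((2 * L + R : ℕ) * R) / R) * 1) ^ 2 / 2 = Λw ^ (2 * i) * Θ := by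
      rw [hΛwe, hΘ, pow_mul]; ring
    rw [e] at h
    exact h
  have hWn₀ : ∀ k ∈ W, (n₀ : ℤ) ≤ |k 0| := fun k hk => (hW k hk).1
  have hη : ∀ k ∈ W, 2 * π * |((k 0 * G : ℤ) : ℝ)| * (Real.exp (-(M ^ 2 / 2)) / (2 * P.N j)) ≤ π * ((Λ' * G : ℕ) : ℝ) * εr / P.N j := by
    intro k hk
    refine le_trans (mul_le_mul_of_nonneg_right (mul_le_mul_of_nonneg_left ?_ (by positivity)) (by positivity))
      (eta_ct_le Λ' G hNpos hεr)
    rw [← Int.cast_abs, abs_mul, abs_of_nonneg (Int.natCast_nonneg G)]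
    have : |k 0| * (G : ℤ) ≤ (Λ' : ℤ) * G := mul_le_mul_of_nonneg_right (hW k hk).2 (Int.natCast_nonneg G)
    exact_mod_cast this
  have hedge' : (K : ℝ) + 1 ≤ (n₀ : ℝ) * G - Λw := by rw [hΛw]; exact hedge
  have hmain := sum_window_sq_norm_hstep_ctg_le P hγ hδ₀ hd hN₀ hρN j hac hasum W χ _ hχS hχn hSL hD hWK hWn₀ hKD hp hΛw0
    hedge' hε (Θp := Θ) (Θm := Θ) (fun i hi y => (hΘpm i hi y).1) (fun i hi y => (hΘpm i hi y).2)
    ((sum_sum_sq_norm_mul_le hχn _ _ _).trans hE) hM hMδ hη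
  rw [hΛw] at hmain
  refine hmain.trans (pow_le_pow_left₀ (by positivity) (add_le_add le_rfl (Real.sqrt_le_sqrt ?_)) 2)
  exact sum_passThrough_le_tsum_h hac hχS hχr hχ1 _ fun n hn => by
    obtain ⟨k, hk, rfl⟩ := Finset.mem_image.mp hn
    exact hW k hk

end Cascade

end Summit.AnomalousDissipation.AnomalousDissipation.Theorems.SawtoothPulseCascade.K1Window
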